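/-
COR-CM (cell pub-hodgecm2) — Δ2 ORIENTATION RE-KEY, hΘ′ DISCHARGE ROUTE 1 (TRANSPORT, «Track T»): THE TRANSPORTED FORM `hΘ′ᶜ` OF THE FIFTH
DISPLAYED HYPOTHESIS `hΘ′` (`SInstance.HThetaAnti`, `CorCM/Rekey/HThetaAnti.lean`), STATED ONCE.  Seat prover-pub-hodgecm2-d2bridge-htheta-1 g0,
2026-08-23.  NEW additive leaf; imports the LANDED junction module `HodgeCM.Model.HThetaJunctionR2B` only (pin theta model `SROGT'C`,
index `LiuIndex.I ∕ line ∕ repAt`, recipe `muLiu`, the pinned dictionary `liuDictionaryPin`).  KERNEL ONLY: reducible `Prop`-valued FAMILIES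
(`abbrev`, like ✔ `SInstance.GOG`; not named facts, no `sorry`, nothing cited) + one instantiation lemma.  Nothing here ASSERTS any of them.
FRAMING: HC_CM is NOT proved; «Δ2 BRIDGE CLOSED» is NOT claimed; HELD pending orientation re-key.
-/
import Summits.HodgeConjecture.HodgeCM.Model.HThetaJunctionR2B

set_option autoImplicit false

/-!
# Re-key, hΘ′ discharge route 1 (TRANSPORT): `SInstance.HThetaAntiConj` — what complex conjugation on the tower delivers

`hΘ′` (`Rekey/HThetaAnti.lean` :60–:109) asks, at a good context `(V, c, i)`, for an index `j` of the pinned family at the slot scalar `a_i`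
ANTI-isometric to the slot line (`(line j).scalar = −(z z̄ · a_i)`) such that every theta class `ω` of the pin theta model `SROGT'C` at slot `i`
lifts to a tower family `cf` with `res cf = ω` and `ofLevel cf ∈ block j`.  The supply OF RECORD ✔ `SInstance.hJ_ROGT'C_block`
(`HThetaJunctionR2B.lean` :270) gives this at the ISOMETRIC index `j₀` (`scalar j₀ = z z̄ · a_i`).  The only map of the model relating the two
blocks is the antilinear involution `F∞ = conj ⊗ id` of the tower (✔ `CorCM/D2Bridge/TowerConj.conjTower`: `U(V)(𝔸_f)`-equivariant,
`conjTower (ofLevel cf) = ofLevel (conjLevel cf)`, `res (conjLevel cf) = conj (res cf)`), and `F∞` carries `block j₀` into `block j` as soon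
as every oscillator module `Ω(line j₀, χ)` is a conjugate-linear equivariant quotient of some `Ω(line j, χ′)` (✔
`LiuAlbaneseModuleDatum.D2Bridge.map_block_le_of_conjTransport`; the Weil-representation content «`ω̄_{ψ,⟨a⟩} ≅ ω_{ψ,⟨−a⟩}`» is ✔
`Literature/NumberTheory/Weil1964/AdelicMetaplecticFinRepConj` + ✔ `CorCM/Rekey/Transport/TwistedCoinvSemilinear`).  Transporting the lift
`cf₀` of `ω` therefore produces a lift of the CONJUGATE class `conj ω = F∞_Γ ω` — a `(0,1)`-class — in `block j`, NOT a lift of `ω`.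
This leaf states that transported form ONCE, in the shape of `HThetaAnti` with `res cf = ω` replaced by `res cf = HodgeStructure.conj ω`:

* `SInstance.HThetaAntiConj … V c i : Prop` — AT ONE CONTEXT («hΘ′ᶜ»);
* `SInstance.HThetaAntiConjAll … : Prop` — the displayed-shape ∀-form (quantifier prefix of `h418′` ∕ `HThetaAntiAll`), `HThetaAntiConjAll.at`;
* `SInstance.OmegaConjSocket … V a j₀ j : Prop` — THE ω-SIDE INPUT of the transport at a slot scalar `a` (the `hΩ` hypothesis of
  `map_block_le_of_conjTransport` at `φ := MulEquiv.refl`, `D = D′ :=` the pinned dictionary): every `Ω(line j₀, χ)`, `χ` automorphic, is the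
  image of a conjugate-linear `ℂ[U(V)(𝔸_f)]`-equivariant surjection out of some `Ω(line j, χ′)`, `χ′` automorphic.  Its intended inhabitant is
  the semilinear descent `eΩ⁻¹` of `C_f : Φ_f ↦ Φ̄_f` (✔ `finSBConjₛₗ`, ✔ `finSBConj_finRepMp`, ✔ `SplitLine.exists_Ω_semilinearEquiv`) at the
  conjugate pair splitting; naming that splitting as an INDEX `j` of `LiuIndex.I V (repAt a) (muLiu ι₁ rep)` (compatibility + central type of
  the conjugate splitting at the section's representative of the class of `−a`) is the open ω-side item (mc-theta-3 (T4b″)∕(T4d)∕(T4e)).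

All three are stated over the LIVE pinned dictionary `HodgeCM.Model.liuDictionaryPin`: the re-keyed pin `HodgeCM.Model.Rekey.liuDictionaryPin`
(LAYER 0) has the SAME `H`, `Adm`, `Ω`, `res` and `block` (`Rekey.liuDictionaryPin_H ∕ _block`, `rfl`) — the re-key moves `PhiMu′ ∕ adm′` only —
so each family below is, token for token, the same proposition at the re-keyed pin.

PLAN OF THE ROUTE (proof files beside this one): (P1) `hThetaAntiConj_of_omegaConjSocket`: `GOG V c →` (ω-socket at the isometric theta index
of ✔ `hJ_ROGT'C_block`, anti-isometric partner) `→ HThetaAntiConj V c i` — ✔ `hJ_ROGT'C_block` ∘ `conjLevel` ∘ `conjTower_ofLevel` ∘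
`map_block_le_of_conjTransport`; (P2) THE VERDICT LEMMA `thetaOf_eq_zero_of_hThetaAntiConj_of_thm418C_bar`: `HThetaAntiConj V c i` + the
re-keyed combined reading r8 at the anti-isometric line (`h418′` read at `a_i`, whose `PhiMu′ j` HOLDS there) + ✔ `thetaOf_subset_H10` ⇒ the theta
classes of `SROGT'C` at slot `i` VANISH below the r8 threshold (`conj ω ∈ span cmClasses′ ⊆ H^{1,0}` by ✔ `cmClasses_subset_hodge_piece_one_zero`
+ K1∕K2 of ✔ `OrientationReflexConj`, while `conj ω ∈ H^{0,1}`; ✔ `disjoint_hodgePiece_one_zero`); (P3) hence `hΘ′` ITSELF holds below that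
threshold with the ZERO lift — i.e. the transport route discharges `hΘ′` relative to `h418′` exactly VACUOUSLY, and {`h418′`, ω-socket, one
non-zero theta class below every threshold} ⊢ `False` (the theta-block instance of wb-5's ✔ `false_pin_of_thm418C_rekey_transport_of_holomorphic_witness`).
So `HThetaAntiConj` is NOT `hΘ′`; it is what the transport CAN prove, and together with `h418′` it decides `hΘ′` only by annihilating its subject.
-/

noncomputable section

open NumberField NumberField.InfinitePlace NumberField.mixedEmbedding IsDedekindDomain
open scoped Matrix Classical TensorProduct SchwartzMap
open MulAction
open Literature.Geometry.ComplexHyperbolic.BallModel (U21 x₀ stabilizerEquivK21)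
open Literature.NumberTheory.Automorphic.U21 (K21 matA sclD)
open Literature.AlgebraicGeometry.ShimuraVarieties Literature.AlgebraicGeometry.ShimuraVarieties.BallForms
open Literature.AlgebraicGeometry.HodgeTheory Literature.NumberTheory.Automorphic.PicardCM
open Literature.NumberTheory.Transcendental (Arapura2012_Cor_15_4_6)
open Literature.NumberTheory.Automorphic Literature.NumberTheory.Automorphic.UnitaryGroup Literature.NumberTheory.Weil1964
open Literature.NumberTheory.GelbartRogawski1991 Literature.NumberTheory.GelbartRogawski1991.UnitaryDualPair
open HodgeCM.Adelic HodgeCM.PerL34 HodgeCM.Model.HypCensus HodgeCM.Model.SupplyInstance HodgeCM.Model.ArchSideTerm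
open HodgeCM.Model.ThetaSpace HodgeCM.Model.TowerLevel HodgeCM.Model.TowerCarrier HodgeCM.Literature.Theta

namespace HodgeCM.Model.Rekey.SInstance

open HodgeCM.Model HodgeCM.Model.SInstance HodgeCM.Model.ThetaAdelicSide HodgeCM.Model.LiuIndex
open Literature.AlgebraicGeometry.Motives (HodgeStructure)

/-- **`hΘ′ᶜ` AT ONE CONTEXT** — the TRANSPORTED anti-isometric junction datum at `(V, c, i)`: an index `j` of the pinned family at the slot
scalar `a_i` with `(line j).scalar = −(z z̄ · a_i)` for some `z ≠ 0`, such that for every theta class `ω` of the pin theta model `SROGT'C` at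
slot `i` (every tower level below conj-three) the CONJUGATE class `conj ω = (conj ⊗ id) ω` is the identity-component value of a tower family
in `block j` of the pinned dictionary.  Verbatim ✔ `SInstance.hJ_ROGT'C_block`'s conclusion with the isometry replaced by an ANTI-isometry and
`res cf = ω` by `res cf = HodgeStructure.conj ω`; stated over the live `liuDictionaryPin` (= the re-keyed pin's `H ∕ block`, `rfl`). [folklore] -/
abbrev HThetaAntiConj (hHD : exists_isReal_hodgeModel) (hI : hodgePQ_independent_of_hodgeModel)
  (h₁ : BallQuotientUniformised) (h₃ : CMAbelianVarietyRealised) (hA : Arapura2012_Cor_15_4_6)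

  (hGR : ∀ {L : CMField} {ι₁ : L →+* ℂ} (V : HermSpace3 L ι₁) (c : SeesawCtx L),
    (cmSplittingDatum (L : Type) finProdFinEquiv (frameD V) (frameD_real V) (frameD_ne V) (dW c.D) (dW_real c.D)
      (dW_ne c.D)).CompatibleSplitting)
  (hGR₀ : ∀ {L : CMField} {ι₁ : L →+* ℂ} (V : HermSpace3 L ι₁) (c : SeesawCtx L),
    (cmSplittingDatum (L : Type) (e₁) (frameD V) (frameD_real V) (frameD_ne V) (lineVec (L : Type) (dW c.D 0))
      (fun _ => dW_real c.D 0) (fun _ => dW_ne c.D 0)).CompatibleSplitting)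
  (hGR₁ : ∀ {L : CMField} {ι₁ : L →+* ℂ} (V : HermSpace3 L ι₁) (c : SeesawCtx L),
    (cmSplittingDatum (L : Type) (e₁) (frameD V) (frameD_real V) (frameD_ne V) (lineVec (L : Type) (dW c.D 1))
      (fun _ => dW_real c.D 1) (fun _ => dW_ne c.D 1)).CompatibleSplitting)
  (hGR₂ : ∀ {L : CMField} {ι₁ : L →+* ℂ} (V : HermSpace3 L ι₁) (c : SeesawCtx L),
    (cmSplittingDatum (L : Type) (e₁) (frameD V) (frameD_real V) (frameD_ne V) (lineVec (L : Type) (dW' c.D 0))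
      (fun _ => dW'_real c.D 0) (fun _ => dW'_ne c.D 0)).CompatibleSplitting)
  (hGR₃ : ∀ {L : CMField} {ι₁ : L →+* ℂ} (V : HermSpace3 L ι₁) (c : SeesawCtx L),
    (cmSplittingDatum (L : Type) (e₁) (frameD V) (frameD_real V) (frameD_ne V) (lineVec (L : Type) (dW' c.D 1))
      (fun _ => dW'_real c.D 1) (fun _ => dW'_ne c.D 1)).CompatibleSplitting)
  (μ : ∀ {L : CMField}, SeesawCtx L → Fin 4 → NumberField.InfinitePlace (L : Type) → ℤ)
  (hΔ₁ : ∀ {L : CMField} {ι₁ : L →+* ℂ} (V : HermSpace3 L ι₁) (c : SeesawCtx L), ∀ hc : GOG V c,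
    slotTypeVec V c (hGR V c) (hGR₀ V c) (hGR₁ V c) (hGR₂ V c) (hGR₃ V c) (hG_GOG V c hc) 1 -
      slotTypeVec V c (hGR V c) (hGR₀ V c) (hGR₁ V c) (hGR₂ V c) (hGR₃ V c) (hG_GOG V c hc) 0 = μ c 1 - μ c 0)
  (hΔ₂ : ∀ {L : CMField} {ι₁ : L →+* ℂ} (V : HermSpace3 L ι₁) (c : SeesawCtx L), ∀ hc : GOG V c,
    slotTypeVec V c (hGR V c) (hGR₀ V c) (hGR₁ V c) (hGR₂ V c) (hGR₃ V c) (hG_GOG V c hc) 2 -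
      slotTypeVec V c (hGR V c) (hGR₀ V c) (hGR₁ V c) (hGR₂ V c) (hGR₃ V c) (hG_GOG V c hc) 0 = μ c 2 - μ c 0)
  (hΔ₃ : ∀ {L : CMField} {ι₁ : L →+* ℂ} (V : HermSpace3 L ι₁) (c : SeesawCtx L), ∀ hc : GOG V c,
    slotTypeVec V c (hGR V c) (hGR₀ V c) (hGR₁ V c) (hGR₂ V c) (hGR₃ V c) (hG_GOG V c hc) 3 -
      slotTypeVec V c (hGR V c) (hGR₀ V c) (hGR₁ V c) (hGR₂ V c) (hGR₃ V c) (hG_GOG V c hc) 0 = μ c 3 - μ c 0)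
    {L : CMField} {ι₁ : L →+* ℂ} (V : HermSpace3 L ι₁) (c : SeesawCtx L) (i : Fin 4) : Prop :=
  ∃ j : LiuIndex.I V (LiuIndex.repAt (⟨c.D.a i, c.D.a_real i, c.D.a_ne i⟩ : LiuIndex.RealScalar L))
      (muLiu ι₁ LiuIndex.GramClass.rep),
    (∃ z : (L : Type), z ≠ 0 ∧
      (LiuIndex.line V (LiuIndex.repAt (⟨c.D.a i, c.D.a_real i, c.D.a_ne i⟩ : LiuIndex.RealScalar L))
        (muLiu ι₁ LiuIndex.GramClass.rep) j).scalar = -(z * conjRingHomK L z * c.D.a i)) ∧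
    ∀ (Γ : Level V) (hΓ : Γ.BelowConjThree),
      ∀ ω ∈ thetaOf _ (thetaClassInputOf _ (fun V c => thetaSpaceInputOf hHD hI h₁ h₃
          (SROGT'C @hGR @hGR₀ @hGR₁ @hGR₂ @hGR₃ @μ hΔ₁ hΔ₂ hΔ₃) V c)) V c i Γ,
        ∃ cf : towerLevel hHD hI (ballQuotientUniformisedDatum_of h₁) h₃ hA Γ hΓ,
          TowerLevel.res hHD hI (ballQuotientUniformisedDatum_of h₁) h₃ hA cf = HodgeStructure.conj ω ∧
            (ofLevel hHD hI (ballQuotientUniformisedDatum_of h₁) h₃ hA Γ hΓ cf :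
                (_root_.HodgeCM.Model.liuDictionaryPin hHD hI h₁ h₃ hA V
                (LiuIndex.I V (LiuIndex.repAt (⟨c.D.a i, c.D.a_real i, c.D.a_ne i⟩ : LiuIndex.RealScalar L))
                  (muLiu ι₁ LiuIndex.GramClass.rep))
                (LiuIndex.line V (LiuIndex.repAt (⟨c.D.a i, c.D.a_real i, c.D.a_ne i⟩ : LiuIndex.RealScalar L))
                  (muLiu ι₁ LiuIndex.GramClass.rep))).H) ∈
              (_root_.HodgeCM.Model.liuDictionaryPin hHD hI h₁ h₃ hA V
                (LiuIndex.I V (LiuIndex.repAt (⟨c.D.a i, c.D.a_real i, c.D.a_ne i⟩ : LiuIndex.RealScalar L))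
                  (muLiu ι₁ LiuIndex.GramClass.rep))
                (LiuIndex.line V (LiuIndex.repAt (⟨c.D.a i, c.D.a_real i, c.D.a_ne i⟩ : LiuIndex.RealScalar L))
                  (muLiu ι₁ LiuIndex.GramClass.rep))).block j

/-- **`hΘ′ᶜ` IN DISPLAYED SHAPE** — `HThetaAntiConj` at EVERY CM field `L`, embedding `ι₁`, `V : HermSpace3 L ι₁`, GOOD seesaw context
(`SInstance.GOG V c`) and slot `i`: the quantifier prefix of `h418′` ∕ `HThetaAntiAll`. [folklore] -/
abbrev HThetaAntiConjAll (hHD : exists_isReal_hodgeModel) (hI : hodgePQ_independent_of_hodgeModel)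
  (h₁ : BallQuotientUniformised) (h₃ : CMAbelianVarietyRealised) (hA : Arapura2012_Cor_15_4_6)

  (hGR : ∀ {L : CMField} {ι₁ : L →+* ℂ} (V : HermSpace3 L ι₁) (c : SeesawCtx L),
    (cmSplittingDatum (L : Type) finProdFinEquiv (frameD V) (frameD_real V) (frameD_ne V) (dW c.D) (dW_real c.D)
      (dW_ne c.D)).CompatibleSplitting)
  (hGR₀ : ∀ {L : CMField} {ι₁ : L →+* ℂ} (V : HermSpace3 L ι₁) (c : SeesawCtx L),
    (cmSplittingDatum (L : Type) (e₁) (frameD V) (frameD_real V) (frameD_ne V) (lineVec (L : Type) (dW c.D 0))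
      (fun _ => dW_real c.D 0) (fun _ => dW_ne c.D 0)).CompatibleSplitting)
  (hGR₁ : ∀ {L : CMField} {ι₁ : L →+* ℂ} (V : HermSpace3 L ι₁) (c : SeesawCtx L),
    (cmSplittingDatum (L : Type) (e₁) (frameD V) (frameD_real V) (frameD_ne V) (lineVec (L : Type) (dW c.D 1))
      (fun _ => dW_real c.D 1) (fun _ => dW_ne c.D 1)).CompatibleSplitting)
  (hGR₂ : ∀ {L : CMField} {ι₁ : L →+* ℂ} (V : HermSpace3 L ι₁) (c : SeesawCtx L),
    (cmSplittingDatum (L : Type) (e₁) (frameD V) (frameD_real V) (frameD_ne V) (lineVec (L : Type) (dW' c.D 0))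
      (fun _ => dW'_real c.D 0) (fun _ => dW'_ne c.D 0)).CompatibleSplitting)
  (hGR₃ : ∀ {L : CMField} {ι₁ : L →+* ℂ} (V : HermSpace3 L ι₁) (c : SeesawCtx L),
    (cmSplittingDatum (L : Type) (e₁) (frameD V) (frameD_real V) (frameD_ne V) (lineVec (L : Type) (dW' c.D 1))
      (fun _ => dW'_real c.D 1) (fun _ => dW'_ne c.D 1)).CompatibleSplitting)
  (μ : ∀ {L : CMField}, SeesawCtx L → Fin 4 → NumberField.InfinitePlace (L : Type) → ℤ)
  (hΔ₁ : ∀ {L : CMField} {ι₁ : L →+* ℂ} (V : HermSpace3 L ι₁) (c : SeesawCtx L), ∀ hc : GOG V c,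
    slotTypeVec V c (hGR V c) (hGR₀ V c) (hGR₁ V c) (hGR₂ V c) (hGR₃ V c) (hG_GOG V c hc) 1 -
      slotTypeVec V c (hGR V c) (hGR₀ V c) (hGR₁ V c) (hGR₂ V c) (hGR₃ V c) (hG_GOG V c hc) 0 = μ c 1 - μ c 0)
  (hΔ₂ : ∀ {L : CMField} {ι₁ : L →+* ℂ} (V : HermSpace3 L ι₁) (c : SeesawCtx L), ∀ hc : GOG V c,
    slotTypeVec V c (hGR V c) (hGR₀ V c) (hGR₁ V c) (hGR₂ V c) (hGR₃ V c) (hG_GOG V c hc) 2 -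
      slotTypeVec V c (hGR V c) (hGR₀ V c) (hGR₁ V c) (hGR₂ V c) (hGR₃ V c) (hG_GOG V c hc) 0 = μ c 2 - μ c 0)
  (hΔ₃ : ∀ {L : CMField} {ι₁ : L →+* ℂ} (V : HermSpace3 L ι₁) (c : SeesawCtx L), ∀ hc : GOG V c,
    slotTypeVec V c (hGR V c) (hGR₀ V c) (hGR₁ V c) (hGR₂ V c) (hGR₃ V c) (hG_GOG V c hc) 3 -
      slotTypeVec V c (hGR V c) (hGR₀ V c) (hGR₁ V c) (hGR₂ V c) (hGR₃ V c) (hG_GOG V c hc) 0 = μ c 3 - μ c 0) : Prop :=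
  ∀ {L : CMField} {ι₁ : L →+* ℂ} (V : HermSpace3 L ι₁) (c : SeesawCtx L), GOG V c → ∀ i : Fin 4,
    HThetaAntiConj hHD hI h₁ h₃ hA @hGR @hGR₀ @hGR₁ @hGR₂ @hGR₃ @μ hΔ₁ hΔ₂ hΔ₃ V c i

/-- Instantiation of the displayed-shape form at one good context. [folklore] -/
theorem HThetaAntiConjAll.at (hHD : exists_isReal_hodgeModel) (hI : hodgePQ_independent_of_hodgeModel)
  (h₁ : BallQuotientUniformised) (h₃ : CMAbelianVarietyRealised) (hA : Arapura2012_Cor_15_4_6)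

  (hGR : ∀ {L : CMField} {ι₁ : L →+* ℂ} (V : HermSpace3 L ι₁) (c : SeesawCtx L),
    (cmSplittingDatum (L : Type) finProdFinEquiv (frameD V) (frameD_real V) (frameD_ne V) (dW c.D) (dW_real c.D)
      (dW_ne c.D)).CompatibleSplitting)
  (hGR₀ : ∀ {L : CMField} {ι₁ : L →+* ℂ} (V : HermSpace3 L ι₁) (c : SeesawCtx L),
    (cmSplittingDatum (L : Type) (e₁) (frameD V) (frameD_real V) (frameD_ne V) (lineVec (L : Type) (dW c.D 0))
      (fun _ => dW_real c.D 0) (fun _ => dW_ne c.D 0)).CompatibleSplitting)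
  (hGR₁ : ∀ {L : CMField} {ι₁ : L →+* ℂ} (V : HermSpace3 L ι₁) (c : SeesawCtx L),
    (cmSplittingDatum (L : Type) (e₁) (frameD V) (frameD_real V) (frameD_ne V) (lineVec (L : Type) (dW c.D 1))
      (fun _ => dW_real c.D 1) (fun _ => dW_ne c.D 1)).CompatibleSplitting)
  (hGR₂ : ∀ {L : CMField} {ι₁ : L →+* ℂ} (V : HermSpace3 L ι₁) (c : SeesawCtx L),
    (cmSplittingDatum (L : Type) (e₁) (frameD V) (frameD_real V) (frameD_ne V) (lineVec (L : Type) (dW' c.D 0))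
      (fun _ => dW'_real c.D 0) (fun _ => dW'_ne c.D 0)).CompatibleSplitting)
  (hGR₃ : ∀ {L : CMField} {ι₁ : L →+* ℂ} (V : HermSpace3 L ι₁) (c : SeesawCtx L),
    (cmSplittingDatum (L : Type) (e₁) (frameD V) (frameD_real V) (frameD_ne V) (lineVec (L : Type) (dW' c.D 1))
      (fun _ => dW'_real c.D 1) (fun _ => dW'_ne c.D 1)).CompatibleSplitting)
  (μ : ∀ {L : CMField}, SeesawCtx L → Fin 4 → NumberField.InfinitePlace (L : Type) → ℤ)
  (hΔ₁ : ∀ {L : CMField} {ι₁ : L →+* ℂ} (V : HermSpace3 L ι₁) (c : SeesawCtx L), ∀ hc : GOG V c,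
    slotTypeVec V c (hGR V c) (hGR₀ V c) (hGR₁ V c) (hGR₂ V c) (hGR₃ V c) (hG_GOG V c hc) 1 -
      slotTypeVec V c (hGR V c) (hGR₀ V c) (hGR₁ V c) (hGR₂ V c) (hGR₃ V c) (hG_GOG V c hc) 0 = μ c 1 - μ c 0)
  (hΔ₂ : ∀ {L : CMField} {ι₁ : L →+* ℂ} (V : HermSpace3 L ι₁) (c : SeesawCtx L), ∀ hc : GOG V c,
    slotTypeVec V c (hGR V c) (hGR₀ V c) (hGR₁ V c) (hGR₂ V c) (hGR₃ V c) (hG_GOG V c hc) 2 -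
      slotTypeVec V c (hGR V c) (hGR₀ V c) (hGR₁ V c) (hGR₂ V c) (hGR₃ V c) (hG_GOG V c hc) 0 = μ c 2 - μ c 0)
  (hΔ₃ : ∀ {L : CMField} {ι₁ : L →+* ℂ} (V : HermSpace3 L ι₁) (c : SeesawCtx L), ∀ hc : GOG V c,
    slotTypeVec V c (hGR V c) (hGR₀ V c) (hGR₁ V c) (hGR₂ V c) (hGR₃ V c) (hG_GOG V c hc) 3 -
      slotTypeVec V c (hGR V c) (hGR₀ V c) (hGR₁ V c) (hGR₂ V c) (hGR₃ V c) (hG_GOG V c hc) 0 = μ c 3 - μ c 0)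
    (hΘ : HThetaAntiConjAll hHD hI h₁ h₃ hA @hGR @hGR₀ @hGR₁ @hGR₂ @hGR₃ @μ hΔ₁ hΔ₂ hΔ₃)
    {L : CMField} {ι₁ : L →+* ℂ} (V : HermSpace3 L ι₁) (c : SeesawCtx L) (hc : GOG V c) (i : Fin 4) :
    HThetaAntiConj hHD hI h₁ h₃ hA @hGR @hGR₀ @hGR₁ @hGR₂ @hGR₃ @μ hΔ₁ hΔ₂ hΔ₃ V c i :=
  hΘ V c hc i

/-- **THE ω-SIDE SOCKET OF THE TRANSPORT at a slot scalar `a`, between two indices `j₀ j` of the pinned family** (the hypothesis `hΩ` of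
✔ `LiuAlbaneseModuleDatum.D2Bridge.map_block_le_of_conjTransport` at `φ := MulEquiv.refl`, source = target = the pinned dictionary at `a`):
for every automorphic character `χ` of the line of `j₀` there are an automorphic character `χ′` of the line of `j` and a CONJUGATE-LINEAR
`U(V)(𝔸_f)`-equivariant SURJECTION `Ω(line j, χ′) → Ω(line j₀, χ)`.  With it, `F∞ (block j₀) ⊆ block j`.  Intended inhabitant (not built
here): `j` the conjugate partner of `j₀` (Gram class `−[a]`, conjugate pair splitting), `θ := eΩ.symm` from ✔ `SplitLine.exists_Ω_semilinearEquiv`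
fed with ✔ `finSBConjₛₗ` ∕ ✔ `finSBConj_finRepMp`. [folklore] -/
abbrev OmegaConjSocket (hHD : exists_isReal_hodgeModel) (hI : hodgePQ_independent_of_hodgeModel)
    (h₁ : BallQuotientUniformised) (h₃ : CMAbelianVarietyRealised) (hA : Arapura2012_Cor_15_4_6)
    {L : CMField} {ι₁ : L →+* ℂ} (V : HermSpace3 L ι₁) (a : LiuIndex.RealScalar L)
    (j₀ j : LiuIndex.I V (LiuIndex.repAt a) (muLiu ι₁ LiuIndex.GramClass.rep)) : Prop :=
  ∀ χ : (_root_.HodgeCM.Model.liuDictionaryPin hHD hI h₁ h₃ hA V (LiuIndex.I V (LiuIndex.repAt a) (muLiu ι₁ LiuIndex.GramClass.rep))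
        (LiuIndex.line V (LiuIndex.repAt a) (muLiu ι₁ LiuIndex.GramClass.rep))).Adm j₀,
    ∃ (χ' : (_root_.HodgeCM.Model.liuDictionaryPin hHD hI h₁ h₃ hA V (LiuIndex.I V (LiuIndex.repAt a) (muLiu ι₁ LiuIndex.GramClass.rep))
        (LiuIndex.line V (LiuIndex.repAt a) (muLiu ι₁ LiuIndex.GramClass.rep))).Adm j)
      (θ : (_root_.HodgeCM.Model.liuDictionaryPin hHD hI h₁ h₃ hA V (LiuIndex.I V (LiuIndex.repAt a) (muLiu ι₁ LiuIndex.GramClass.rep))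
        (LiuIndex.line V (LiuIndex.repAt a) (muLiu ι₁ LiuIndex.GramClass.rep))).Ω j χ' →ₗ⋆[ℂ]
        (_root_.HodgeCM.Model.liuDictionaryPin hHD hI h₁ h₃ hA V (LiuIndex.I V (LiuIndex.repAt a) (muLiu ι₁ LiuIndex.GramClass.rep))
        (LiuIndex.line V (LiuIndex.repAt a) (muLiu ι₁ LiuIndex.GramClass.rep))).Ω j₀ χ),
      Function.Surjective θ ∧
        ∀ (g : ↥V.adelicFin) (y : (_root_.HodgeCM.Model.liuDictionaryPin hHD hI h₁ h₃ hA V (LiuIndex.I V (LiuIndex.repAt a) (muLiu ι₁ LiuIndex.GramClass.rep))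
        (LiuIndex.line V (LiuIndex.repAt a) (muLiu ι₁ LiuIndex.GramClass.rep))).Ω j χ'),
          θ (MonoidAlgebra.of ℂ ↥V.adelicFin g • y) = MonoidAlgebra.of ℂ ↥V.adelicFin g • θ y

end HodgeCM.Model.Rekey.SInstance

end
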